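import Summits.ResolutionOfSingularities.ResolutionOfSingularities.Theorems.HilbertSamuelEliminationSigmaMaxModificationsCorridor3WLadderIsoTailsFormalFrameAssemblyStep
import HarnessLib

/-!
# [OURS · L1 W4.2 · D14 ROUTE H/G «K1 FREE-RATIONAL TAILS»] G1a-2, part 2/2: the TOWER OF FORMAL FRAMES along a free-rational tail
# and the osculating arc `ψ₀(h₀) ∈ (X_i − Σ_k c_{k,i} t^k)_{i=1,2,3}^m`
# (crux `SigmaMaxModifications` stmt-ResolutionOfSingularities-18506 / conjunct stmt-…-19249; kernel `IsoQuadraticTowerTerminates p 3`,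
# card C5 K1; `--supports stmt-ResolutionOfSingularities-19249`, helper)

Prover res-D-pv-010 (HIRONAKA-L D lane, gen 10) on res-L1-w42-plan-1's RULING v3.14-15 (DT) «G1a-2 TOWER ASSEMBLY := res-D-pv-010»,
cut of record res-L1-w42-lead-1 2026-08-27T10:43:09Z (G1a-2); sequel of part 1/2 `…IsoTailsFormalFrameAssemblyStep` (p529646,
`FormalFrame.exists_frameStep`). HELPER file (`--supports stmt-…-19249`): closes no item, introduces no definition, asserts nothing of
[Hironaka2017] nor of [CossartJannsenSaito2020] / [CossartPiltant2008, 2009]; imports no `Theses` file. AI-written; AI review is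
weaker than expert review.

## What is proved

* `exists_arc_of_frameTower_of_baseFrame` — along a point tower `(T, pt)` (`T.C n = {x_n}` closed, `π_n(x_{n+1}) = x_n`) ALL of
  whose steps are rational (`IsRationalStep`) and non-satellite (`¬ IsSatelliteStep`) and along which `H^{(0)}` of the local rings
  does not move (res-type-001's H1 `IsoTailsHS.hilbertSamuelFun_stalk_eq_of_isIsoPointTower`, here in the successive form
  `H^{(0)}(𝒪_{x_{n+1}}) = H^{(0)}(𝒪_{x_n})`), starting from a hypersurface presentation `σ : R ↠ 𝒪_{X_0,x_0}` (`R` regular local,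
  `emb.dim R = 4`, regular system `x` with (FREE) at `t = x 0` for the first step — res-type-071's `exists_index_forall_dvd` up to
  reindexing —, `ker σ = (h)`, `h ∈ 𝔪^m ∖ 𝔪^{m+1}`) and ANY base frame `ψ₀ : R → κ⟦X⟧` (local, `ψ₀ (x i) = X i`, surjective
  residue map): `∃ c : ℕ → Fin 4 → κ, ψ₀ h ∈ (X 1 − Σ_k c_{k,1} t^k, X 2 − Σ_k c_{k,2} t^k, X 3 − Σ_k c_{k,3} t^k)^m`.
  PROOF: the stage invariant `P n` = the eleven clauses of `exists_frameStep`; a sequence of stages `st n` by recursion on `n`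
  (`Nat.rec` + choice on `exists_frameStep`), the links `ψ_{n+1} ∘ ι_n = (y ↦ t y + c_{n+1} t) ∘ ψ_n`, `ι_n h_n = t^m h_{n+1}` read
  off by choice, and res-L1-w42-lead-1's glue `FormalFrame.mem_pow_of_frameTower` (p524558). No definition is introduced: the
  invariant, the link predicate and the state space are local terms of the proof.
* `exists_frameTower_arc` — the same with the base frame SUPPLIED by res-type-038's `exists_baseFrame_of_rsop` (G1a-1, Cohen
  coordinates `Ψ : κ⟦X₀,…,X₃⟧ ≃+* R̂` adapted to `x`, `κ = ResidueField R̂`, coefficient field from a field `k₀ ⊆ R`): output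
  `∃ Ψ ψ₀ c, (∀ r, Ψ (ψ₀ r) = algebraMap R R̂ r) ∧ (∀ i, Ψ (X i) = algebraMap R R̂ (x i)) ∧ ψ₀ h ∈ (…)^m` — VERBATIM the input
  `(Ψ, ψ₀, hψ₀, c, hhP)` of res-type-001's H7∞ socket `IsoTailsHS.not_isIsolatedInHSMaxLocus_adicCompletion_of_frameTowerArc` (p525298),
  whose conclusion `¬ IsIsolatedInHSMaxLocus (Spec Â) N (closedPoint Â)` contradicts H8
  (`IdeasL1C4.isIsolatedInHSMaxLocus_adicCompletion_of_ringEquiv`, p526213) at an isolated stage: this is H∞ (res-L1-w42-lead-1).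
* `exists_frameTower_arc_of_charP` — prime characteristic (`𝔽_p ⊆ R`, `exists_subring_isField_of_charP`).

Hypotheses, honestly: the tail is indexed from `0` (the consumer shifts the tower to the stage `n₀` where the free-rational tail
starts); (FREE) for the first step is a hypothesis at the index `0` of the given regular system (obtained from `exists_index_forall_dvd`
by permuting the system); the Hilbert–Samuel input is only `H^{(0)}`, successive form.

## References

* V. Cossart, O. Piltant, J. Algebra 321 (2009) ch. 3 I.9 (the formal arc of a free-rational tail) [CossartPiltant2009]; J. Algebra
  320 (2008), proof of Lemma 4.3 (3) [CossartPiltant2008].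
* H. Matsumura, *Commutative Ring Theory* (1986), Thm. 29.7 (Cohen structure theorem with prescribed variables). [Matsumura1987]
* V. Cossart, U. Jannsen, S. Saito, LNM 2270 (2020), Def. 6.34 (towers). [CossartJannsenSaito2020]
-/

noncomputable section

set_option linter.dupNamespace false -- mandated namespace of this single-conjunct summit

open MvPowerSeries IsLocalRing AlgebraicGeometry CategoryTheory
open Literature.AlgebraicGeometry.Resolution Literature.RingTheory.HilbertSamuel
open Literature.AlgebraicGeometry.CossartJannsenSaito2020

namespace Summit.ResolutionOfSingularities.ResolutionOfSingularities.Cruxes.SigmaMaxModifications.IdeasL1C5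

universe u

namespace FormalFrame

/-! ### §4. The recursion: a tower of frames along a free-rational tail, and the arc -/

section Tower

set_option maxHeartbeats 1600000 in
-- the stage invariant is a long conjunction over stalks (as in res-type-071's socket files)
/-- **G1a-2 — THE TOWER OF FORMAL FRAMES AND THE OSCULATING ARC (base frame given).** Along a point tower
(`T.C n = {x_n}` closed, `π_n(x_{n+1}) = x_n`) ALL of whose steps are rational and non-satellite and along which `H^{(0)}` of the
local rings does not move, starting from a hypersurface presentation `σ : R ↠ 𝒪_{X_0,x_0}` (`R` regular local, `emb.dim R = 4`, regular
system `x` with (FREE) at `t = x 0` for the first step, `ker σ = (h)`, `h ∈ 𝔪^m ∖ 𝔪^{m+1}`) and a BASE FRAME `ψ₀ : R → κ⟦X⟧` (local,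
`ψ₀ (x i) = X i`, surjective residue map — res-type-038's `exists_baseFrame_of_rsop`), there are constants `c : ℕ → Fin 4 → κ` with
`ψ₀ h ∈ (X 1 − Σ_k c_{k,1} t^k, X 2 − Σ_k c_{k,2} t^k, X 3 − Σ_k c_{k,3} t^k)^m`. Proof: iterate `exists_frameStep` (part 1/2) by
recursion on `n` (choice), and feed the resulting tower to res-L1-w42-lead-1's `FormalFrame.mem_pow_of_frameTower`.
[OURS · L1 W4.2] [cite: CossartPiltant2009, ch. 3 I.9] -/
theorem exists_arc_of_frameTower_of_baseFrame (T : BlowupTower.{u}) (pt : ∀ n, T.X n)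
    (hC : ∀ n, T.C n = {pt n}) (hcl : ∀ n, IsClosed ({pt n} : Set (T.X n)))
    (hpt : ∀ n, (T.π n) (pt (n + 1)) = pt n)
    (hrat : ∀ n, IsRationalStep T pt n) (hnsat : ∀ n, ¬ IsSatelliteStep T pt n)
    (hHS : ∀ n, hilbertSamuelFun ((T.X (n + 1)).presheaf.stalk (pt (n + 1))) 0 =
      hilbertSamuelFun ((T.X n).presheaf.stalk (pt n)) 0)
    {R : Type u} [CommRing R] [IsRegularLocalRing R] (hd : (maximalIdeal R).spanFinrank = 4)
    (x : Fin 4 → R) (hx : Ideal.span (Set.range x) = maximalIdeal R)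
    (σ : R →+* (T.X 0).presheaf.stalk (pt 0)) (hσ : Function.Surjective σ) {h : R}
    (hker : RingHom.ker σ = Ideal.span {h}) {m : ℕ} (hm : h ∈ maximalIdeal R ^ m) (hm' : h ∉ maximalIdeal R ^ (m + 1))
    (hfree : ∀ k, ((T.π 0).stalkMap (pt (0 + 1))).hom (((T.X 0).presheaf.stalkCongr (.of_eq (hpt 0))).inv (σ (x 0))) ∣
      ((T.π 0).stalkMap (pt (0 + 1))).hom (((T.X 0).presheaf.stalkCongr (.of_eq (hpt 0))).inv (σ (x k))))
    {κ : Type u} [Field κ] (ψ₀ : R →+* MvPowerSeries (Fin 4) κ) [IsLocalHom ψ₀] (hψx : ∀ i, ψ₀ (x i) = X i)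
    (hres : ∀ a : κ, ∃ r : R, ψ₀ r - C a ∈ maximalIdeal (MvPowerSeries (Fin 4) κ)) :
    ∃ c : ℕ → Fin 4 → κ, ψ₀ h ∈ (Ideal.span ({X 1 - Series.tSeries (fun k => c k 1), X 2 - Series.tSeries (fun k => c k 2),
      X 3 - Series.tSeries (fun k => c k 3)} : Set (MvPowerSeries (Fin 4) κ))) ^ m := by
  classical
  -- the stage invariant (the eleven clauses of `exists_frameStep`)
  obtain ⟨P, hP⟩ : ∃ P : ∀ (n : ℕ) (S : Type u) [CommRing S] [IsRegularLocalRing S], (Fin 4 → S) →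
      (S →+* (T.X n).presheaf.stalk (pt n)) → S → (S →+* MvPowerSeries (Fin 4) κ) → (Fin 4 → κ) → Prop,
      P = fun (n : ℕ) (S : Type u) [CommRing S] [IsRegularLocalRing S] (y : Fin 4 → S)
          (τ : S →+* (T.X n).presheaf.stalk (pt n)) (g : S) (φ : S →+* MvPowerSeries (Fin 4) κ) (l : Fin 4 → κ) =>
        (maximalIdeal S).spanFinrank = 4 ∧ Ideal.span (Set.range y) = maximalIdeal S ∧
        Function.Surjective τ ∧ RingHom.ker τ = Ideal.span {g} ∧ g ∈ maximalIdeal S ^ m ∧ g ∉ maximalIdeal S ^ (m + 1) ∧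
        (∀ k, ((T.π n).stalkMap (pt (n + 1))).hom (((T.X n).presheaf.stalkCongr (.of_eq (hpt n))).inv (τ (y 0))) ∣
          ((T.π n).stalkMap (pt (n + 1))).hom (((T.X n).presheaf.stalkCongr (.of_eq (hpt n))).inv (τ (y k)))) ∧
        IsLocalHom φ ∧ φ (y 0) = X 0 ∧
        (∀ i, i ≠ 0 → φ (y i) - X i - C (l i) * X 0 ∈ maximalIdeal (MvPowerSeries (Fin 4) κ) ^ 2) ∧
        (∀ a : κ, ∃ r : S, φ r - C a ∈ maximalIdeal (MvPowerSeries (Fin 4) κ)) := ⟨_, rfl⟩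
  -- the links between consecutive stages (the hypotheses of `mem_pow_of_frameTower`)
  obtain ⟨L, hL⟩ : ∃ L : ∀ (S : Type u) [CommRing S] (S' : Type u) [CommRing S'],
      (S →+* MvPowerSeries (Fin 4) κ) → (S' →+* MvPowerSeries (Fin 4) κ) → S → S' → S' → Prop,
      L = fun (S : Type u) [CommRing S] (S' : Type u) [CommRing S'] (φ : S →+* MvPowerSeries (Fin 4) κ)
          (φ' : S' →+* MvPowerSeries (Fin 4) κ) (g : S) (t' g' : S') =>
        ∃ (ι : S →+* S') (c₁ : Fin 4 → κ), (∀ r, φ' (ι r) = subst (Series.transChartSubst c₁) (φ r)) ∧ ι g = t' ^ m * g' :=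
    ⟨_, rfl⟩
  -- the state space
  obtain ⟨St, hSt⟩ : ∃ St : ℕ → Type (u + 1), St = fun n =>
      Σ' (S : Type u) (i : CommRing S) (j : IsRegularLocalRing S) (y : Fin 4 → S) (τ : S →+* (T.X n).presheaf.stalk (pt n))
        (g : S) (φ : S →+* MvPowerSeries (Fin 4) κ) (l : Fin 4 → κ), @P n S i j y τ g φ l := ⟨_, rfl⟩
  subst hSt
  -- the step
  have hstep : ∀ n (s : (fun n => Σ' (S : Type u) (i : CommRing S) (j : IsRegularLocalRing S) (y : Fin 4 → S)
      (τ : S →+* (T.X n).presheaf.stalk (pt n)) (g : S) (φ : S →+* MvPowerSeries (Fin 4) κ) (l : Fin 4 → κ),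
      @P n S i j y τ g φ l) n),
      ∃ s' : (fun n => Σ' (S : Type u) (i : CommRing S) (j : IsRegularLocalRing S) (y : Fin 4 → S)
        (τ : S →+* (T.X n).presheaf.stalk (pt n)) (g : S) (φ : S →+* MvPowerSeries (Fin 4) κ) (l : Fin 4 → κ),
        @P n S i j y τ g φ l) (n + 1),
        @L s.1 s.2.1 s'.1 s'.2.1 s.2.2.2.2.2.2.1 s'.2.2.2.2.2.2.1 s.2.2.2.2.2.1 (s'.2.2.2.1 0) s'.2.2.2.2.2.1 := by
    intro n s
    obtain ⟨S, i, j, y, τ, g, φ, l, hPn⟩ := s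
    rw [hP] at hPn
    obtain ⟨h1, h2, h3, h4, h5, h6, h7, h8, h9, h10, h11⟩ := hPn
    obtain ⟨R', i', j', x', σ', h', ψ', lam', ι, c₁, hr⟩ :=
      @exists_frameStep κ _ T pt n (hC n) (hcl n) (hpt n) (hpt (n + 1)) (hrat n) (hnsat n) (hHS n) S i j h1 y h2 τ h3 g h4
        m h5 h6 h7 φ h8 h9 l h10 h11
    have hP' : @P (n + 1) R' i' j' x' σ' h' ψ' lam' := by
      rw [hP]
      exact ⟨hr.1, hr.2.1, hr.2.2.1, hr.2.2.2.1, hr.2.2.2.2.1, hr.2.2.2.2.2.1, hr.2.2.2.2.2.2.1, hr.2.2.2.2.2.2.2.1,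
        hr.2.2.2.2.2.2.2.2.1, hr.2.2.2.2.2.2.2.2.2.1, hr.2.2.2.2.2.2.2.2.2.2.1⟩
    have hL' : @L S i R' i' φ ψ' g (x' 0) h' := by
      rw [hL]
      exact ⟨ι, c₁, hr.2.2.2.2.2.2.2.2.2.2.2.1, hr.2.2.2.2.2.2.2.2.2.2.2.2⟩
    exact ⟨⟨R', i', j', x', σ', h', ψ', lam', hP'⟩, hL'⟩
  -- the base stage
  have hP0 : @P 0 R _ _ x σ h ψ₀ (fun _ => 0) := by
    rw [hP]
    refine ⟨hd, hx, hσ, hker, hm, hm', hfree, inferInstance, hψx 0, fun i _ => ?_, hres⟩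
    rw [hψx i, map_zero, zero_mul, sub_self, sub_zero]
    exact Ideal.zero_mem _
  -- the recursion (choice)
  obtain ⟨st, hst0, hst⟩ : ∃ st : ∀ n, (fun n => Σ' (S : Type u) (i : CommRing S) (j : IsRegularLocalRing S) (y : Fin 4 → S)
      (τ : S →+* (T.X n).presheaf.stalk (pt n)) (g : S) (φ : S →+* MvPowerSeries (Fin 4) κ) (l : Fin 4 → κ),
      @P n S i j y τ g φ l) n,
      st 0 = ⟨R, inferInstance, inferInstance, x, σ, h, ψ₀, fun _ => 0, hP0⟩ ∧
        ∀ n, st (n + 1) = Classical.choose (hstep n (st n)) :=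
    ⟨fun n => Nat.rec (motive := fun n => (fun n => Σ' (S : Type u) (i : CommRing S) (j : IsRegularLocalRing S)
        (y : Fin 4 → S) (τ : S →+* (T.X n).presheaf.stalk (pt n)) (g : S) (φ : S →+* MvPowerSeries (Fin 4) κ)
        (l : Fin 4 → κ), @P n S i j y τ g φ l) n)
      ⟨R, inferInstance, inferInstance, x, σ, h, ψ₀, fun _ => 0, hP0⟩ (fun n s => Classical.choose (hstep n s)) n,
      rfl, fun n => rfl⟩
  letI : ∀ n, CommRing (st n).1 := fun n => (st n).2.1
  have hlink : ∀ n, ∃ (ι : (st n).1 →+* (st (n + 1)).1) (c₁ : Fin 4 → κ),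
      (∀ r, (st (n + 1)).2.2.2.2.2.2.1 (ι r) = subst (Series.transChartSubst c₁) ((st n).2.2.2.2.2.2.1 r)) ∧
        ι (st n).2.2.2.2.2.1 = (st (n + 1)).2.2.2.1 0 ^ m * (st (n + 1)).2.2.2.2.2.1 := by
    intro n
    have hs := Classical.choose_spec (hstep n (st n))
    rw [← hst n, hL] at hs
    exact hs
  -- read off the tower
  choose ι c₁ hcomm hstrict using hlink
  let c : ℕ → Fin 4 → κ := fun n => Nat.rec (motive := fun _ => Fin 4 → κ) (fun _ => 0) (fun k _ => c₁ k) n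
  have hc : ∀ n, c (n + 1) = c₁ n := fun n => rfl
  have hPt : ∀ (n : ℕ) (S : Type u) [CommRing S] [IsRegularLocalRing S] (y : Fin 4 → S)
      (τ : S →+* (T.X n).presheaf.stalk (pt n)) (g : S) (φ : S →+* MvPowerSeries (Fin 4) κ) (l : Fin 4 → κ),
      @P n S _ _ y τ g φ l → φ (y 0) = X 0 := by
    intro n S _ _ y τ g φ l hq
    rw [hP] at hq
    exact hq.2.2.2.2.2.2.2.2.1
  have ht : ∀ n, (st n).2.2.2.2.2.2.1 ((st n).2.2.2.1 0) = X 0 := fun n =>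
    @hPt n (st n).1 (st n).2.1 (st n).2.2.1 (st n).2.2.2.1 (st n).2.2.2.2.1 (st n).2.2.2.2.2.1 (st n).2.2.2.2.2.2.1
      (st n).2.2.2.2.2.2.2.1 (st n).2.2.2.2.2.2.2.2
  have key := @mem_pow_of_frameTower κ _ (fun n => (st n).1) (fun n => (st n).2.1) ι (fun n => (st n).2.2.2.2.2.2.1) c
    (fun n => (st n).2.2.2.1 0) (fun n => (st n).2.2.2.2.2.1) m (fun n r => by rw [hc]; exact hcomm n r) ht hstrict
  have key' : (st 0).2.2.2.2.2.2.1 (st 0).2.2.2.2.2.1 ∈ (Ideal.span ({X 1 - Series.tSeries (fun k => c k 1),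
      X 2 - Series.tSeries (fun k => c k 2), X 3 - Series.tSeries (fun k => c k 3)} : Set (MvPowerSeries (Fin 4) κ))) ^ m :=
    key
  rw [hst0] at key'
  exact ⟨c, key'⟩

/-- **G1a-2 — THE OSCULATING ARC OF A FREE-RATIONAL TAIL, in the currency of H7∞/H8.** As
`exists_arc_of_frameTower_of_baseFrame`, with the base frame supplied by res-type-038's `exists_baseFrame_of_rsop` (Cohen coordinates of
`R̂` adapted to `x`, over a coefficient field; `R ⊇ k₀` a field): there are Cohen coordinates `Ψ : κ⟦X₀,…,X₃⟧ ≃+* R̂`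
(`κ = ResidueField R̂`, `Ψ (X i) = x i`), the base frame `ψ₀ = Ψ⁻¹ ∘ (R → R̂)` and constants `c` with
`ψ₀ h ∈ (X 1 − Σ_k c_{k,1} t^k, X 2 − Σ_k c_{k,2} t^k, X 3 − Σ_k c_{k,3} t^k)^m` — VERBATIM the input `(Ψ, ψ₀, hψ₀, c, hhP)` of
res-type-001's `IsoTailsHS.not_isIsolatedInHSMaxLocus_adicCompletion_of_frameTowerArc` (p525298). [OURS · L1 W4.2]
[cite: CossartPiltant2009, ch. 3 I.9] [cite: Matsumura1987, Thm. 29.7] -/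
theorem exists_frameTower_arc (T : BlowupTower.{u}) (pt : ∀ n, T.X n)
    (hC : ∀ n, T.C n = {pt n}) (hcl : ∀ n, IsClosed ({pt n} : Set (T.X n)))
    (hpt : ∀ n, (T.π n) (pt (n + 1)) = pt n)
    (hrat : ∀ n, IsRationalStep T pt n) (hnsat : ∀ n, ¬ IsSatelliteStep T pt n)
    (hHS : ∀ n, hilbertSamuelFun ((T.X (n + 1)).presheaf.stalk (pt (n + 1))) 0 =
      hilbertSamuelFun ((T.X n).presheaf.stalk (pt n)) 0)
    {R : Type u} [CommRing R] [IsRegularLocalRing R] (k₀ : Subring R) (hk₀ : IsField k₀)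
    (hd : (maximalIdeal R).spanFinrank = 4) (x : Fin 4 → R) (hx : Ideal.span (Set.range x) = maximalIdeal R)
    (σ : R →+* (T.X 0).presheaf.stalk (pt 0)) (hσ : Function.Surjective σ) {h : R}
    (hker : RingHom.ker σ = Ideal.span {h}) {m : ℕ} (hm : h ∈ maximalIdeal R ^ m) (hm' : h ∉ maximalIdeal R ^ (m + 1))
    (hfree : ∀ k, ((T.π 0).stalkMap (pt (0 + 1))).hom (((T.X 0).presheaf.stalkCongr (.of_eq (hpt 0))).inv (σ (x 0))) ∣
      ((T.π 0).stalkMap (pt (0 + 1))).hom (((T.X 0).presheaf.stalkCongr (.of_eq (hpt 0))).inv (σ (x k)))) :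
    ∃ (Ψ : MvPowerSeries (Fin 4) (ResidueField (AdicCompletion (maximalIdeal R) R)) ≃+* AdicCompletion (maximalIdeal R) R)
      (ψ₀ : R →+* MvPowerSeries (Fin 4) (ResidueField (AdicCompletion (maximalIdeal R) R)))
      (c : ℕ → Fin 4 → ResidueField (AdicCompletion (maximalIdeal R) R)),
      (∀ r, Ψ (ψ₀ r) = algebraMap R (AdicCompletion (maximalIdeal R) R) r) ∧
      (∀ i, Ψ (X i) = algebraMap R (AdicCompletion (maximalIdeal R) R) (x i)) ∧
      ψ₀ h ∈ (Ideal.span ({X 1 - Series.tSeries (fun k => c k 1), X 2 - Series.tSeries (fun k => c k 2),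
        X 3 - Series.tSeries (fun k => c k 3)} : Set (MvPowerSeries (Fin 4) (ResidueField (AdicCompletion (maximalIdeal R) R))))) ^ m := by
  obtain ⟨_, Ψ, ψ₀, -, -, hΨX, hΨψ, hloc, hψx, hres⟩ := exists_baseFrame_of_rsop R k₀ hk₀ hd x hx
  haveI := hloc
  obtain ⟨c, hc⟩ := exists_arc_of_frameTower_of_baseFrame T pt hC hcl hpt hrat hnsat hHS hd x hx σ hσ hker hm hm' hfree ψ₀ hψx
    hres
  exact ⟨Ψ, ψ₀, c, hΨψ, hΨX, hc⟩

/-- **G1a-2 in prime characteristic** (the W4.2 stages are local rings of schemes over a field of characteristic `p`, so `𝔽_p ⊆ R`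
is the coefficient field: res-type-038's `exists_subring_isField_of_charP`). [OURS · L1 W4.2] [cite: CossartPiltant2009, ch. 3 I.9] -/
theorem exists_frameTower_arc_of_charP (T : BlowupTower.{u}) (pt : ∀ n, T.X n)
    (hC : ∀ n, T.C n = {pt n}) (hcl : ∀ n, IsClosed ({pt n} : Set (T.X n)))
    (hpt : ∀ n, (T.π n) (pt (n + 1)) = pt n)
    (hrat : ∀ n, IsRationalStep T pt n) (hnsat : ∀ n, ¬ IsSatelliteStep T pt n)
    (hHS : ∀ n, hilbertSamuelFun ((T.X (n + 1)).presheaf.stalk (pt (n + 1))) 0 =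
      hilbertSamuelFun ((T.X n).presheaf.stalk (pt n)) 0)
    {R : Type u} [CommRing R] [IsRegularLocalRing R] (p : ℕ) [Fact p.Prime] [CharP R p]
    (hd : (maximalIdeal R).spanFinrank = 4) (x : Fin 4 → R) (hx : Ideal.span (Set.range x) = maximalIdeal R)
    (σ : R →+* (T.X 0).presheaf.stalk (pt 0)) (hσ : Function.Surjective σ) {h : R}
    (hker : RingHom.ker σ = Ideal.span {h}) {m : ℕ} (hm : h ∈ maximalIdeal R ^ m) (hm' : h ∉ maximalIdeal R ^ (m + 1))
    (hfree : ∀ k, ((T.π 0).stalkMap (pt (0 + 1))).hom (((T.X 0).presheaf.stalkCongr (.of_eq (hpt 0))).inv (σ (x 0))) ∣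
      ((T.π 0).stalkMap (pt (0 + 1))).hom (((T.X 0).presheaf.stalkCongr (.of_eq (hpt 0))).inv (σ (x k)))) :
    ∃ (Ψ : MvPowerSeries (Fin 4) (ResidueField (AdicCompletion (maximalIdeal R) R)) ≃+* AdicCompletion (maximalIdeal R) R)
      (ψ₀ : R →+* MvPowerSeries (Fin 4) (ResidueField (AdicCompletion (maximalIdeal R) R)))
      (c : ℕ → Fin 4 → ResidueField (AdicCompletion (maximalIdeal R) R)),
      (∀ r, Ψ (ψ₀ r) = algebraMap R (AdicCompletion (maximalIdeal R) R) r) ∧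
      (∀ i, Ψ (X i) = algebraMap R (AdicCompletion (maximalIdeal R) R) (x i)) ∧
      ψ₀ h ∈ (Ideal.span ({X 1 - Series.tSeries (fun k => c k 1), X 2 - Series.tSeries (fun k => c k 2),
        X 3 - Series.tSeries (fun k => c k 3)} : Set (MvPowerSeries (Fin 4) (ResidueField (AdicCompletion (maximalIdeal R) R))))) ^ m := by
  obtain ⟨k₀, hk₀⟩ := exists_subring_isField_of_charP R p
  exact exists_frameTower_arc T pt hC hcl hpt hrat hnsat hHS k₀ hk₀ hd x hx σ hσ hker hm hm' hfree

end Tower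

end FormalFrame

end Summit.ResolutionOfSingularities.ResolutionOfSingularities.Cruxes.SigmaMaxModifications.IdeasL1C5

end
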